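import Summits.BirchSwinnertonDyer.BirchSwinnertonDyer.Theorems.GenusKolyvaginAtTwoPowDvdShaCardAtTwoRTLadderFrame
import Summits.BirchSwinnertonDyer.BirchSwinnertonDyer.Theorems.GenusKolyvaginAtTwoPowDvdShaCardAtTwoRTSelmerLadder
import HarnessLib

/-!
# Route `GenusKolyvaginAtTwo`, LINE 18 (L_T `PowDvdShaCardAtTwoRT`, stmt-BirchSwinnertonDyer-23242), THE crux 3a⁗
# `stub_twinExhibitionGenus` (v4.4; Shallow regime of v4.5) — THE LOSS-FREE FRAME: two `Ш`-level budgets (this seat) ∘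
# pigeonhole repair (gk2-p2) ∘ twin bookkeeping ⇒ `2·M₀ ≤ ord₂ g + ord₂ g′` from McCallum-shaped supplies with `2^B − 1` spares

Seat `bsd-line-gk2-p3` g18 (cell `bsd-f1-sign2`), `--supports stmt-BirchSwinnertonDyer-23242` (helper; closes nothing).
THEOREMS ONLY (no definition, no named fact, no `sorry`); BSD is not proved by any of this.

The sibling `…RTLadderFrame` pays the genus loss per side and repays one bit by Cassels–Tate parity.  gk2-p2 g15's
`…RTStrictSupply` shows a better device: a RELAXED supply avoiding `2j + #(defects∖0)` classes yields a STRICT class of undiminished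
order (pigeonhole on the defects), so NO bit is lost.  This file runs that device in the `Ш`-currency of this seat's budgets
(`res⁻¹(Ш(X_K/K)) ≤ H¹(ℚ, X)`, index `≤ 2^{ord₂ C(Wd)}` on both sides, `…RTRelaxedShaGenusBudget` / `…RTLadderFrame`):

* §1 `two_mul_sum_le_padicValNat_sha_of_shaSupply` — for `X/ℚ` with `Ш(X/ℚ)[2^∞]` finite and
  `[res⁻¹(Ш(X_K/K)) : Ш(X/ℚ)] ≤ h` (finite): if for every `j < k` and every `≤ 2j + (h − 1)` classes of `H¹(ℚ, X)` there is a
  class of `2`-power order divisible by `2^{a_j}` restricting into `Ш(X_K/K)` and avoiding them, then `2 Σ a_j ≤ ord₂ #Ш(X/ℚ)[2^∞]`.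
* §2 **`two_mul_le_padicValNat_add_of_shaSupplies`** — LINE 18 frame (`W` globally minimal, `Δ<0`, `C(W)` odd; `K` Heegner, `d_K` odd;
  `Wd = Cd • W^{(d_K)}`), antitone ladder `M`, `M_{2T} = 0`; supplies over `W` (odd depths, exponent `M_{2m}−M_{2m+1}`) and over `Wd`
  (even depths, exponent `M_{2m+1}−M_{2m+2}`), each avoiding `2m + (2^{ord₂ C(Wd)} − 1)` given classes ⇒ **`2·M₀ ≤ ord₂ g + ord₂ g′`**;
  **`…_of_padicValNat_eq_one`** — on `ord₂ C(Wd) = 1` the avoidance budget is `2m + 1` on BOTH sides (McCallum's rank `r = 2m+1` at odd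
  depth; `r − 1 = 2m+1` at even depth `r = 2m+2` after the Kummer line), and `2·M₀ ≤ ord₂ g + ord₂ g′` gives 3a⁗/3a‴ a fortiori
  (`twinExhibitionGenus_ineq_of_shaSupplies_of_padicValNat_eq_one`).
What remains for the Shallow regime is exactly the two supplies = McCallum Prop. 5.2 over `ℚ` at `2` (Q2 + Q5R + reciprocity).

References: [McCallumLMS1991] §5 Prop. 5.2, Thm. 5.4, p. 310; [Kramer1981] §2 Prop. 3, Thm. 1; [GrossLMS1991] Prop. 5.4.
-/

set_option autoImplicit false
-- the Theorems namespace of this sub repeats the summit name by design (D-0017 nested layout)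
set_option linter.dupNamespace false

noncomputable section

open scoped Classical

namespace Summit.BirchSwinnertonDyer.BirchSwinnertonDyer.Theorems.GenusExact.PlusDescent

open WeierstrassCurve NumberField IsDedekindDomain Rat.HeightOneSpectrum Literature.NumberTheory.EllipticCurves
  Literature.Barriers.BirchSwinnertonDyer AddSubgroup

/-! ## §1 One side: a supply in `H¹(ℚ, X)` restricting into `Ш(X_K/K)` -/

section OneSide

variable (K : Type) [Field K] [NumberField K] (X : WeierstrassCurve ℚ) [X.IsElliptic]

/-- **One side of the loss-free frame.**  Let `Ш(X/ℚ)[2^∞]` be finite and `R = res⁻¹(Ш(X_K/K)) ≤ H¹(ℚ, X)` contain `Ш(X/ℚ)`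
with finite index `≤ h`.  If for every `j < k` every `≤ 2j + (h − 1)` classes of `H¹(ℚ, X)` are avoided by a class `z` of
`2`-power order with `2^{a_j} ∣ ord z` and `res_K z ∈ Ш(X_K/K)`, then `2 Σ_{j<k} a_j ≤ ord₂ #Ш(X/ℚ)[2^∞]` — NO loss: the
relaxation defects live in the finite `R/Ш(X/ℚ)` (`h − 1` non-zero values) and gk2-p2's pigeonhole repair
`pow_dvd_natCard_primaryComponent_sha_of_relaxed_supply` spends the `h − 1` spare generators on them.
[cite: McCallumLMS1991, §5 Prop. 5.2 and p. 310] -/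
theorem two_mul_sum_le_padicValNat_sha_of_shaSupply {h : ℕ} (k : ℕ) (a : ℕ → ℕ)
    (hg : 0 < Nat.card (AddCommGroup.primaryComponent X.sha 2))
    (hidx : (X.sha).relIndex (((X.baseChange K).sha).comap (resBaseChange X K)) ≠ 0)
    (hle : (X.sha).relIndex (((X.baseChange K).sha).comap (resBaseChange X K)) ≤ h)
    (hsup : ∀ j < k, ∀ s : Finset X.galH1, s.card ≤ 2 * j + (h - 1) →
      ∃ z : X.galH1, resBaseChange X K z ∈ (X.baseChange K).sha ∧ (∃ N : ℕ, 2 ^ N • z = 0) ∧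
        2 ^ a j ∣ addOrderOf z ∧ Disjoint (zmultiples z) (closure (s : Set X.galH1))) :
    2 * ∑ j ∈ Finset.range k, a j ≤ padicValNat 2 (Nat.card (AddCommGroup.primaryComponent X.sha 2)) := by
  haveI : Finite (AddCommGroup.primaryComponent X.sha 2) := Nat.finite_of_card_ne_zero hg.ne'
  set R : AddSubgroup X.galH1 := ((X.baseChange K).sha).comap (resBaseChange X K) with hR
  -- the relaxed classes of `2`-power order, the defect map `π : H¹(ℚ,X) → H¹(ℚ,X)/Ш(X/ℚ)` and its finite set of values on `R`
  set R' : AddSubgroup X.galH1 := R ⊓ AddCommGroup.primaryComponent X.galH1 2 with hR'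
  let π : X.galH1 →+ X.galH1 ⧸ X.sha := QuotientAddGroup.mk' X.sha
  have hfinF : (R.map π : Set (X.galH1 ⧸ X.sha)).Finite := by
    have hc : Nat.card (R.map π) ≠ 0 := by rw [natCard_map_mk'_eq_relIndex]; exact hidx
    exact Nat.finite_of_card_ne_zero hc
  set F : Finset (X.galH1 ⧸ X.sha) := hfinF.toFinset with hF
  have hmemF : ∀ z ∈ R, π z ∈ F := fun z hz ↦ by
    rw [hF, Set.Finite.mem_toFinset]
    exact ⟨z, hz, rfl⟩
  have hFcard : F.card ≤ h := by
    have h1 : F.card = Nat.card (R.map π) := by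
      rw [hF, ← Set.ncard_eq_toFinset_card _ hfinF]
      exact (Nat.card_coe_set_eq _).symm
    rw [h1, natCard_map_mk'_eq_relIndex]
    exact hle
  have h0F : (0 : X.galH1 ⧸ X.sha) ∈ F := by
    have := hmemF 0 R.zero_mem
    rwa [map_zero] at this
  have hFerase : (F.erase 0).card ≤ h - 1 := by
    rw [Finset.card_erase_of_mem h0F]
    omega
  -- strictness: a `2`-power-order class of `R` with no defect lies in `Ш(X/ℚ)[2^∞]`
  have hstrict : ∀ z ∈ R', π z = 0 → z ∈ (AddCommGroup.primaryComponent X.sha 2).map X.sha.subtype := by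
    intro z hz hπ
    obtain ⟨-, hz2⟩ := AddSubgroup.mem_inf.mp hz
    obtain ⟨N, hN⟩ := (AddCommGroup.mem_primaryComponent).mp hz2
    have hzsha : z ∈ X.sha := (QuotientAddGroup.eq_zero_iff z).mp hπ
    exact mem_map_primaryComponent_sha_of_nsmul_eq_zero X 2 hzsha hN
  refine two_mul_sum_le_padicValNat_natCard_primaryComponent_sha_of_relaxed_supply X 2 R' π F hstrict k a
    fun j hj s hs ↦ ?_
  obtain ⟨z, hzres, ⟨N, hN⟩, hdvd, hdisj⟩ := hsup j hj s (hs.trans (by omega))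
  have hzR : z ∈ R := AddSubgroup.mem_comap.mpr hzres
  refine ⟨z, AddSubgroup.mem_inf.mpr ⟨hzR, (AddCommGroup.mem_primaryComponent).mpr ⟨N, hN⟩⟩, hdvd, hmemF z hzR, hdisj⟩

end OneSide

/-! ## §2 The loss-free frame on LINE 18 -/

section Frame

variable (W : WeierstrassCurve ℚ) [W.IsElliptic] [W.IsGloballyMinimal] (K : Type) [Field K] [NumberField K]
  {Wd : WeierstrassCurve ℚ} [Wd.IsElliptic]

/-- **THE LOSS-FREE FRAME THEOREM FOR 3a⁗/3a‴.**  On the LINE 18 frame (`W/ℚ` globally minimal elliptic, `Δ_W < 0`, `C(W)` odd; `K`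
imaginary quadratic, `d_K` odd, Heegner for `N_W`; `Wd = Cd • W^{(d_K)}` elliptic; `Ш(W/ℚ)[2^∞]`, `Ш(Wd/ℚ)[2^∞]` finite of orders
`g, g′`), with `B := ord₂ C(Wd)` and an antitone ladder `M`, `M_{2T} = 0`: if for every `m < T` every `≤ 2m + (2^B − 1)` classes of
`H¹(ℚ, W)` are avoided by a `2`-power-order class `z` with `2^{M_{2m}−M_{2m+1}} ∣ ord z` restricting into `Ш(W_K/K)` (McCallum's
odd-depth classes, Prop. 5.2 over `ℚ` at `2`), and likewise over `Wd` with `2^{M_{2m+1}−M_{2m+2}}` and `Ш(Wd_K/K)` (even depth), then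
**`2·M₀ ≤ ord₂ g + ord₂ g′`** — no genus term at all.  (§1 on both sides with `h = 2^B` from the two `Ш`-level budgets.)
[cite: McCallumLMS1991, §5 Prop. 5.2, Thm. 5.4, Cor. 5.6] [cite: Kramer1981, §2 Prop. 3 and Thm. 1] -/
theorem two_mul_le_padicValNat_add_of_shaSupplies (hΔ : W.Δ < 0) (hT : Odd W.tamagawaProduct)
    (hIQ : IsImaginaryQuadratic K) (hodd : Odd (NumberField.discr K)) (hHe : SatisfiesHeegnerHypothesis (W.conductorNorm ℤ) K)
    (Cd : VariableChange ℚ) (hWd : Cd • W.quadraticTwist (NumberField.discr K : ℚ) = Wd)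
    (hg : 0 < Nat.card (AddCommGroup.primaryComponent W.sha 2)) (hg' : 0 < Nat.card (AddCommGroup.primaryComponent Wd.sha 2))
    (T : ℕ) (M : ℕ → ℕ) (hM : ∀ j, M (j + 1) ≤ M j) (hMT : M (2 * T) = 0)
    (hsup : ∀ m < T, ∀ s : Finset W.galH1, s.card ≤ 2 * m + (2 ^ padicValNat 2 Wd.tamagawaProduct - 1) →
      ∃ z : W.galH1, resBaseChange W K z ∈ (W.baseChange K).sha ∧ (∃ N : ℕ, 2 ^ N • z = 0) ∧
        2 ^ (M (2 * m) - M (2 * m + 1)) ∣ addOrderOf z ∧ Disjoint (zmultiples z) (closure (s : Set W.galH1)))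
    (hsup' : ∀ m < T, ∀ s : Finset Wd.galH1, s.card ≤ 2 * m + (2 ^ padicValNat 2 Wd.tamagawaProduct - 1) →
      ∃ z : Wd.galH1, resBaseChange Wd K z ∈ (Wd.baseChange K).sha ∧ (∃ N : ℕ, 2 ^ N • z = 0) ∧
        2 ^ (M (2 * m + 1) - M (2 * m + 2)) ∣ addOrderOf z ∧ Disjoint (zmultiples z) (closure (s : Set Wd.galH1))) :
    2 * M 0 ≤ padicValNat 2 (Nat.card (AddCommGroup.primaryComponent W.sha 2)) +
      padicValNat 2 (Nat.card (AddCommGroup.primaryComponent Wd.sha 2)) := by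
  obtain ⟨hne₁, hle₁⟩ :=
    relIndex_sha_comap_resBaseChange_le_two_pow_padicValNat_tamagawaProduct_twin_of_Δ_neg W K hΔ hIQ hodd hHe hT Cd hWd
  obtain ⟨hne₂, hle₂⟩ := relIndex_sha_comap_resBaseChange_twin_le_two_pow W hΔ hIQ hodd hHe hT Cd hWd
  have h₁ := two_mul_sum_le_padicValNat_sha_of_shaSupply K W T (fun m ↦ M (2 * m) - M (2 * m + 1)) hg hne₁ hle₁ hsup
  have h₂ := two_mul_sum_le_padicValNat_sha_of_shaSupply K Wd T (fun m ↦ M (2 * m + 1) - M (2 * m + 2)) hg' hne₂ hle₂ hsup'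
  have hsum : 2 * ∑ m ∈ Finset.range T, (M (2 * m) - M (2 * m + 1)) +
      2 * ∑ m ∈ Finset.range T, (M (2 * m + 1) - M (2 * m + 2)) =
      2 * ∑ j ∈ Finset.range (2 * T), (M j - M (j + 1)) := by
    rw [sum_range_two_mul (fun j => M j - M (j + 1)), ← mul_add, ← Finset.sum_add_distrib]
  rw [sum_range_sub_eq_of_antitone M hM, hMT, Nat.sub_zero] at hsum
  omega

/-- **On `ord₂ C(Wd) = 1`: McCallum's own avoidance budget `2m + 1` on both sides, and 3a⁗/3a‴ with room to spare.**  With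
`ord₂ C(Wd) = 1` the supplies need avoid only `2m + 1` classes per rung (odd depth `r = 2m+1`: Prop. 5.2's rank `r`; even depth
`r = 2m+2`: rank `r` minus the Kummer line of `Wd(ℚ)`), and the conclusion `2·M₀ ≤ ord₂ g + ord₂ g′` implies the registered texts
of 3a⁗ (`+ ord₂ C(Wd)`) and of 3a‴ (`+ ord₂ C(Wd) − 1`). [cite: McCallumLMS1991, §5 Prop. 5.2, Thm. 5.4, Cor. 5.6] -/
theorem twinExhibitionGenus_ineq_of_shaSupplies_of_padicValNat_eq_one (hΔ : W.Δ < 0) (hT : Odd W.tamagawaProduct)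
    (hIQ : IsImaginaryQuadratic K) (hodd : Odd (NumberField.discr K)) (hHe : SatisfiesHeegnerHypothesis (W.conductorNorm ℤ) K)
    (Cd : VariableChange ℚ) (hWd : Cd • W.quadraticTwist (NumberField.discr K : ℚ) = Wd)
    (hB : padicValNat 2 Wd.tamagawaProduct = 1)
    (hg : 0 < Nat.card (AddCommGroup.primaryComponent W.sha 2)) (hg' : 0 < Nat.card (AddCommGroup.primaryComponent Wd.sha 2))
    (T : ℕ) (M : ℕ → ℕ) (hM : ∀ j, M (j + 1) ≤ M j) (hMT : M (2 * T) = 0)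
    (hsup : ∀ m < T, ∀ s : Finset W.galH1, s.card ≤ 2 * m + 1 →
      ∃ z : W.galH1, resBaseChange W K z ∈ (W.baseChange K).sha ∧ (∃ N : ℕ, 2 ^ N • z = 0) ∧
        2 ^ (M (2 * m) - M (2 * m + 1)) ∣ addOrderOf z ∧ Disjoint (zmultiples z) (closure (s : Set W.galH1)))
    (hsup' : ∀ m < T, ∀ s : Finset Wd.galH1, s.card ≤ 2 * m + 1 →
      ∃ z : Wd.galH1, resBaseChange Wd K z ∈ (Wd.baseChange K).sha ∧ (∃ N : ℕ, 2 ^ N • z = 0) ∧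
        2 ^ (M (2 * m + 1) - M (2 * m + 2)) ∣ addOrderOf z ∧ Disjoint (zmultiples z) (closure (s : Set Wd.galH1))) :
    (2 * M 0 : ℤ) ≤ (padicValNat 2 (Nat.card (AddCommGroup.primaryComponent W.sha 2)) : ℤ) +
      (padicValNat 2 (Nat.card (AddCommGroup.primaryComponent Wd.sha 2)) : ℤ) ∧
    (2 * M 0 : ℤ) ≤ (padicValNat 2 (Nat.card (AddCommGroup.primaryComponent W.sha 2)) : ℤ) +
      (padicValNat 2 (Nat.card (AddCommGroup.primaryComponent Wd.sha 2)) : ℤ) +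
      (padicValNat 2 Wd.tamagawaProduct : ℤ) - 1 := by
  have h21 : 2 ^ padicValNat 2 Wd.tamagawaProduct - 1 = 1 := by rw [hB]; norm_num
  have h := two_mul_le_padicValNat_add_of_shaSupplies W K hΔ hT hIQ hodd hHe Cd hWd hg hg' T M hM hMT
    (fun m hm s hs ↦ hsup m hm s (by rw [h21] at hs; exact hs))
    (fun m hm s hs ↦ hsup' m hm s (by rw [h21] at hs; exact hs))
  set a := padicValNat 2 (Nat.card (AddCommGroup.primaryComponent W.sha 2)) with ha
  set b := padicValNat 2 (Nat.card (AddCommGroup.primaryComponent Wd.sha 2)) with hb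
  rw [hB]
  push_cast
  constructor <;> omega

end Frame

end Summit.BirchSwinnertonDyer.BirchSwinnertonDyer.Theorems.GenusExact.PlusDescent

end
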